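import Mathlib
import HarnessLib

/-!
# Route `F4SubCurvatureDoor`, crux ⟨stmt-QuantumFields-23125⟩ `RationalToGeneral`: LINE g18-A v5 — CSF build plan C3a, entry point:
# SMEARED SLICES of a Laplace–Fourier measure (σ-finiteness, Fubini, moments in `E`, differentiation in `t`, Chebyshev)

The registered stub `stub_channelShellForm` reads the channel structure of a class kernel off its LAPLACE–FOURIER MEASURE `μ`
(S1 ✓p696429/p697330: `K(t, z⃗) = ∫ e^{−tE} cos⟪q⃗, z⃗⟫ dμ(E, q⃗)` for `t > 0`, `μ ≥ 0` carried by `E ≥ 0`, `∫ e^{−tE} dμ < ∞`).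
Every momentum-side computation of the owner's plan (`Lines/sextic_channel_stubplans.md` §4 C3a «Stieltjes slices»:
`K_χ(t) := ∫ K(t, z⃗) χ̌(z⃗) dz⃗ = ∫ e^{−E|t|} χ(q⃗) dμ`) starts with the elementary calculus of such measures, which this def-free file
provides for an ABSTRACT Laplace–Fourier pair `(k, μ)` (instantiate `k t z := K (timeSpace t z)`):

* `sigmaFinite_of_integrable_exp` — `∫ e^{−tE} dμ < ∞` for one `t` makes `μ` σ-finite (so Fubini applies);
* ★ `integral_smeared_eq` — for `t > 0` and `φ ∈ L¹(ℝ³)`: `∫ k(t, z⃗) φ(z⃗) dz⃗ = ∫ e^{−tE} Φ(q⃗) dμ(E, q⃗)` with `Φ(q⃗) = ∫ cos⟪q⃗, z⃗⟫ φ(z⃗) dz⃗`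
  (the smeared slice is the Laplace transform in `E` of the `Φ`-weighted measure; `Φ ≥ 0` for `φ` of positive type);
* `integrable_pow_mul_exp_mul` — all `E`-moments of `e^{−tE}Φ(q⃗) dμ` are finite (`E^n e^{−tE} ≤ n!(2/t)^n e^{−tE/2}` on `E ≥ 0`);
* `hasDerivAt_integral_exp_mul` — `d/dt ∫ e^{−tE} Φ dμ = −∫ E e^{−tE} Φ dμ` on `t > 0` (dominated differentiation): time derivatives
  of smeared slices are `E`-moments;
* `setIntegral_le_exp_mul_integral` — Chebyshev: `∫_{E ≤ 1/t} Φ dμ ≤ e · ∫ e^{−tE} Φ dμ` for `Φ ≥ 0`, `t > 0` (the growth bound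
  `ν_χ([0, E]) ≤ e·K_χ(1/E)` of the plan's §4(a)).

THEOREMS ONLY; Mathlib only; no `sorry`; standard axioms.  HONEST LABEL: measure-theory bookkeeping for an OPEN XL stub; nothing here
bears on C3, T1″, ⟨23125⟩ / ⟨23035⟩, rung R2d or the summit; the Yang–Mills mass gap is NOT proved; no summit is proved by a line.
Seat `ym-line-frs-p2` g14 (free hands), `--supports stmt-QuantumFields-23125`. [cite: GlimmJaffeQP1987, §6.2] [folklore]
-/

set_option autoImplicit false

noncomputable section

namespace Summit.QuantumFields.YangMills.Theorems.F4SubCurvatureDoorSmearedSlices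

open MeasureTheory Filter Set
open scoped BigOperators Topology

/-! ## § 1. σ-finiteness -/

/-- A measure on `ℝ × ℝ³` against which `e^{−tE}` is integrable (for one real `t`) is σ-finite: the slabs `{|E| ≤ n}` have
finite measure (`e^{−tE} ≥ e^{−|t| n}` there) and exhaust. [folklore] -/
theorem sigmaFinite_of_integrable_exp (μ : Measure (ℝ × EuclideanSpace ℝ (Fin 3))) {t : ℝ}
    (hint : Integrable (fun p : ℝ × EuclideanSpace ℝ (Fin 3) => Real.exp (-(t * p.1))) μ) : SigmaFinite μ := by
  refine ⟨⟨{ set := fun n => {p | |p.1| ≤ n}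
             set_mem := fun _ => Set.mem_univ _
             finite := fun n => ?_
             spanning := ?_ }⟩⟩
  · have hc : (0 : ℝ) < Real.exp (-(|t| * n)) := Real.exp_pos _
    refine lt_of_le_of_lt (measure_mono fun p hp => ?_) (hint.measure_ge_lt_top hc)
    simp only [Set.mem_setOf_eq] at hp ⊢
    apply Real.exp_le_exp.mpr
    have h1 : t * p.1 ≤ |t| * n := by
      calc t * p.1 ≤ |t * p.1| := le_abs_self _
        _ = |t| * |p.1| := abs_mul _ _
        _ ≤ |t| * n := mul_le_mul_of_nonneg_left hp (abs_nonneg _)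
    linarith
  · refine Set.eq_univ_of_forall fun p => ?_
    obtain ⟨n, hn⟩ := exists_nat_ge |p.1|
    exact Set.mem_iUnion.mpr ⟨n, hn⟩

/-- The support condition `μ (E < 0) = 0` in almost-everywhere form. [folklore] -/
theorem ae_nonneg_of_measure_Iio (μ : Measure (ℝ × EuclideanSpace ℝ (Fin 3)))
    (h0 : μ (Set.Iio (0 : ℝ) ×ˢ (Set.univ : Set (EuclideanSpace ℝ (Fin 3)))) = 0) :
    ∀ᵐ p ∂μ, 0 ≤ p.1 := by
  rw [ae_iff]
  have : {p : ℝ × EuclideanSpace ℝ (Fin 3) | ¬ 0 ≤ p.1} = Set.Iio (0 : ℝ) ×ˢ Set.univ := by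
    ext p; simp [not_le]
  rw [this, h0]

/-! ## § 2. Fubini: smeared slices are Laplace transforms -/

/-- ★ **Smeared slice = Laplace transform.**  If `k(t, z⃗) = ∫ e^{−tE} cos⟪q⃗, z⃗⟫ dμ(E, q⃗)` and `e^{−tE}` is `μ`-integrable, then
for every `φ ∈ L¹(ℝ³)`: `∫ k(t, z⃗) φ(z⃗) dz⃗ = ∫ e^{−tE} (∫ cos⟪q⃗, z⃗⟫ φ(z⃗) dz⃗) dμ(E, q⃗)`. [cite: GlimmJaffeQP1987, §6.2] -/
theorem integral_smeared_eq (μ : Measure (ℝ × EuclideanSpace ℝ (Fin 3))) (t : ℝ)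
    (hint : Integrable (fun p : ℝ × EuclideanSpace ℝ (Fin 3) => Real.exp (-(t * p.1))) μ)
    (k : EuclideanSpace ℝ (Fin 3) → ℝ)
    (hk : ∀ z, k z = ∫ p, Real.exp (-(t * p.1)) * Real.cos (inner ℝ p.2 z) ∂μ)
    (φ : EuclideanSpace ℝ (Fin 3) → ℝ) (hφ : Integrable φ) :
    ∫ z, k z * φ z = ∫ p, Real.exp (-(t * p.1)) * (∫ z, Real.cos (inner ℝ p.2 z) * φ z) ∂μ := by
  haveI : SigmaFinite μ := sigmaFinite_of_integrable_exp μ hint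
  -- the joint integrand and its integrability on the product
  have hmeas : AEStronglyMeasurable
      (Function.uncurry fun (z : EuclideanSpace ℝ (Fin 3)) (p : ℝ × EuclideanSpace ℝ (Fin 3)) =>
        Real.exp (-(t * p.1)) * Real.cos (inner ℝ p.2 z) * φ z) (volume.prod μ) := by
    have h1 : Continuous fun w : EuclideanSpace ℝ (Fin 3) × (ℝ × EuclideanSpace ℝ (Fin 3)) =>
        Real.exp (-(t * w.2.1)) * Real.cos (inner ℝ w.2.2 w.1) := by
      fun_prop
    have h2 : AEStronglyMeasurable (fun w : EuclideanSpace ℝ (Fin 3) × (ℝ × EuclideanSpace ℝ (Fin 3)) => φ w.1)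
        (volume.prod μ) := hφ.aestronglyMeasurable.comp_fst
    exact h1.aestronglyMeasurable.mul h2
  have hprod : Integrable
      (Function.uncurry fun (z : EuclideanSpace ℝ (Fin 3)) (p : ℝ × EuclideanSpace ℝ (Fin 3)) =>
        Real.exp (-(t * p.1)) * Real.cos (inner ℝ p.2 z) * φ z) (volume.prod μ) := by
    refine (hφ.norm.mul_prod hint).mono' hmeas (Eventually.of_forall fun ⟨z, p⟩ => ?_)
    show ‖Real.exp (-(t * p.1)) * Real.cos (inner ℝ p.2 z) * φ z‖ ≤ ‖φ z‖ * Real.exp (-(t * p.1))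
    rw [Real.norm_eq_abs, Real.norm_eq_abs, abs_mul, abs_mul, abs_of_pos (Real.exp_pos _)]
    have hcos : |Real.cos (inner ℝ p.2 z)| ≤ 1 := Real.abs_cos_le_one _
    have hφ0 : 0 ≤ |φ z| := abs_nonneg _
    have he : 0 ≤ Real.exp (-(t * p.1)) := (Real.exp_pos _).le
    calc Real.exp (-(t * p.1)) * |Real.cos (inner ℝ p.2 z)| * |φ z|
        = (Real.exp (-(t * p.1)) * |φ z|) * |Real.cos (inner ℝ p.2 z)| := by ring
      _ ≤ (Real.exp (-(t * p.1)) * |φ z|) * 1 := mul_le_mul_of_nonneg_left hcos (mul_nonneg he hφ0)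
      _ = |φ z| * Real.exp (-(t * p.1)) := by ring
  -- Fubini
  calc ∫ z, k z * φ z
      = ∫ z : EuclideanSpace ℝ (Fin 3), ∫ p : ℝ × EuclideanSpace ℝ (Fin 3),
          Real.exp (-(t * p.1)) * Real.cos (inner ℝ p.2 z) * φ z ∂μ := by
        refine integral_congr_ae (Eventually.of_forall fun z => ?_)
        simp only [hk z, ← integral_mul_const]
    _ = ∫ p : ℝ × EuclideanSpace ℝ (Fin 3), (∫ z : EuclideanSpace ℝ (Fin 3),
          Real.exp (-(t * p.1)) * Real.cos (inner ℝ p.2 z) * φ z) ∂μ := integral_integral_swap hprod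
    _ = ∫ p, Real.exp (-(t * p.1)) * (∫ z, Real.cos (inner ℝ p.2 z) * φ z) ∂μ := by
        refine integral_congr_ae (Eventually.of_forall fun p => ?_)
        simp only [mul_assoc, integral_const_mul]

/-! ## § 3. Moments in `E` and differentiation in `t` -/

/-- `E^n e^{−tE} ≤ n! (2/t)^n e^{−tE/2}` for `E ≥ 0`, `t > 0`. [folklore] -/
theorem pow_mul_exp_le {t : ℝ} (ht : 0 < t) (n : ℕ) {E : ℝ} (hE : 0 ≤ E) :
    E ^ n * Real.exp (-(t * E)) ≤ n.factorial * (2 / t) ^ n * Real.exp (-(t / 2 * E)) := by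
  have hx : 0 ≤ t / 2 * E := by positivity
  have h := Real.pow_div_factorial_le_exp _ hx n
  have hfac : (0 : ℝ) < n.factorial := by exact_mod_cast Nat.factorial_pos n
  rw [div_le_iff₀ hfac, mul_pow] at h
  -- `E^n = (2/t)^n (t/2 · E)^n`
  have hE' : E ^ n = (2 / t) ^ n * (t / 2 * E) ^ n := by
    rw [← mul_pow]; congr 1; field_simp
  have hexp : Real.exp (-(t * E)) = Real.exp (-(t / 2 * E)) * Real.exp (-(t / 2 * E)) := by
    rw [← Real.exp_add]; congr 1; ring
  rw [hE', hexp]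
  have h2 : (t / 2 * E) ^ n * Real.exp (-(t / 2 * E)) ≤ n.factorial := by
    rw [mul_pow]
    have hexp' : Real.exp (t / 2 * E) * Real.exp (-(t / 2 * E)) = 1 := by
      rw [← Real.exp_add, add_neg_cancel, Real.exp_zero]
    calc (t / 2) ^ n * E ^ n * Real.exp (-(t / 2 * E))
        ≤ (Real.exp (t / 2 * E) * n.factorial) * Real.exp (-(t / 2 * E)) :=
          mul_le_mul_of_nonneg_right h (Real.exp_pos _).le
      _ = n.factorial * (Real.exp (t / 2 * E) * Real.exp (-(t / 2 * E))) := by ring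
      _ = n.factorial := by rw [hexp', mul_one]
  have hpos : 0 ≤ (2 / t) ^ n := by positivity
  have hpos' : 0 ≤ Real.exp (-(t / 2 * E)) := (Real.exp_pos _).le
  calc (2 / t) ^ n * (t / 2 * E) ^ n * (Real.exp (-(t / 2 * E)) * Real.exp (-(t / 2 * E)))
      = (2 / t) ^ n * Real.exp (-(t / 2 * E)) * ((t / 2 * E) ^ n * Real.exp (-(t / 2 * E))) := by ring
    _ ≤ (2 / t) ^ n * Real.exp (-(t / 2 * E)) * n.factorial :=
        mul_le_mul_of_nonneg_left h2 (mul_nonneg hpos hpos')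
    _ = n.factorial * (2 / t) ^ n * Real.exp (-(t / 2 * E)) := by ring

/-- **All `E`-moments of the smeared slice measure are finite**: for `t > 0` and bounded measurable `Φ`,
`E ↦ E^n e^{−tE} Φ(q⃗)` is `μ`-integrable. [folklore] -/
theorem integrable_pow_mul_exp_mul (μ : Measure (ℝ × EuclideanSpace ℝ (Fin 3)))
    (h0 : μ (Set.Iio (0 : ℝ) ×ˢ (Set.univ : Set (EuclideanSpace ℝ (Fin 3)))) = 0)
    (hint : ∀ t : ℝ, 0 < t → Integrable (fun p : ℝ × EuclideanSpace ℝ (Fin 3) => Real.exp (-(t * p.1))) μ)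
    (Φ : EuclideanSpace ℝ (Fin 3) → ℝ) (hΦm : Measurable Φ) {C : ℝ} (hΦb : ∀ q, |Φ q| ≤ C)
    {t : ℝ} (ht : 0 < t) (n : ℕ) :
    Integrable (fun p : ℝ × EuclideanSpace ℝ (Fin 3) => p.1 ^ n * Real.exp (-(t * p.1)) * Φ p.2) μ := by
  have hC : 0 ≤ C := (abs_nonneg _).trans (hΦb 0)
  refine ((hint (t / 2) (by positivity)).const_mul (n.factorial * (2 / t) ^ n * C)).mono' ?_ ?_
  · have h1 : Measurable fun p : ℝ × EuclideanSpace ℝ (Fin 3) => p.1 ^ n * Real.exp (-(t * p.1)) := by fun_prop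
    exact (h1.mul (hΦm.comp measurable_snd)).aestronglyMeasurable
  · filter_upwards [ae_nonneg_of_measure_Iio μ h0] with p hp
    rw [Real.norm_eq_abs, abs_mul, abs_mul, abs_of_nonneg (pow_nonneg hp n), abs_of_pos (Real.exp_pos _)]
    calc p.1 ^ n * Real.exp (-(t * p.1)) * |Φ p.2|
        ≤ (n.factorial * (2 / t) ^ n * Real.exp (-(t / 2 * p.1))) * C :=
          mul_le_mul (pow_mul_exp_le ht n hp) (hΦb _) (abs_nonneg _) (by positivity)
      _ = n.factorial * (2 / t) ^ n * C * Real.exp (-(t / 2 * p.1)) := by ring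

/-- **Time derivatives of smeared slices are `E`-moments**: for `t₀ > 0` and bounded measurable `Φ`,
`d/dt|_{t₀} ∫ e^{−tE} Φ(q⃗) dμ = −∫ E e^{−t₀E} Φ(q⃗) dμ`. [folklore] -/
theorem hasDerivAt_integral_exp_mul (μ : Measure (ℝ × EuclideanSpace ℝ (Fin 3)))
    (h0 : μ (Set.Iio (0 : ℝ) ×ˢ (Set.univ : Set (EuclideanSpace ℝ (Fin 3)))) = 0)
    (hint : ∀ t : ℝ, 0 < t → Integrable (fun p : ℝ × EuclideanSpace ℝ (Fin 3) => Real.exp (-(t * p.1))) μ)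
    (Φ : EuclideanSpace ℝ (Fin 3) → ℝ) (hΦm : Measurable Φ) {C : ℝ} (hΦb : ∀ q, |Φ q| ≤ C)
    {t₀ : ℝ} (ht₀ : 0 < t₀) :
    HasDerivAt (fun t : ℝ => ∫ p, Real.exp (-(t * p.1)) * Φ p.2 ∂μ)
      (-∫ p, p.1 * Real.exp (-(t₀ * p.1)) * Φ p.2 ∂μ) t₀ := by
  have hC : 0 ≤ C := (abs_nonneg _).trans (hΦb 0)
  -- integrability of the integrand and of the dominating function
  have hF : ∀ t : ℝ, 0 < t → Integrable (fun p : ℝ × EuclideanSpace ℝ (Fin 3) => Real.exp (-(t * p.1)) * Φ p.2) μ := by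
    intro t ht
    simpa using integrable_pow_mul_exp_mul μ h0 hint Φ hΦm hΦb ht 0
  have hmeasF : ∀ t : ℝ, AEStronglyMeasurable (fun p : ℝ × EuclideanSpace ℝ (Fin 3) => Real.exp (-(t * p.1)) * Φ p.2) μ := by
    intro t
    have h1 : Measurable fun p : ℝ × EuclideanSpace ℝ (Fin 3) => Real.exp (-(t * p.1)) := by fun_prop
    exact (h1.mul (hΦm.comp measurable_snd)).aestronglyMeasurable
  have hmeasF' : AEStronglyMeasurable
      (fun p : ℝ × EuclideanSpace ℝ (Fin 3) => -(p.1 * Real.exp (-(t₀ * p.1)) * Φ p.2)) μ := by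
    have h1 : Measurable fun p : ℝ × EuclideanSpace ℝ (Fin 3) => p.1 * Real.exp (-(t₀ * p.1)) := by fun_prop
    exact (h1.mul (hΦm.comp measurable_snd)).aestronglyMeasurable.neg
  have hbound : Integrable (fun p : ℝ × EuclideanSpace ℝ (Fin 3) => p.1 ^ 1 * Real.exp (-(t₀ / 2 * p.1)) * |C|) μ := by
    have h := integrable_pow_mul_exp_mul μ h0 hint (fun _ => |C|) measurable_const (C := |C|)
      (fun _ => by rw [abs_abs]) (half_pos ht₀) 1
    exact h
  have key := hasDerivAt_integral_of_dominated_loc_of_deriv_le (μ := μ) (x₀ := t₀)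
    (F := fun (t : ℝ) (p : ℝ × EuclideanSpace ℝ (Fin 3)) => Real.exp (-(t * p.1)) * Φ p.2)
    (F' := fun (t : ℝ) (p : ℝ × EuclideanSpace ℝ (Fin 3)) => -(p.1 * Real.exp (-(t * p.1)) * Φ p.2))
    (s := Set.Ioi (t₀ / 2)) (bound := fun p => p.1 ^ 1 * Real.exp (-(t₀ / 2 * p.1)) * |C|)
    (Ioi_mem_nhds (by linarith)) (Eventually.of_forall hmeasF) (hF t₀ ht₀) hmeasF' ?_ hbound ?_
  · simpa [integral_neg] using key.2
  · -- the bound on `s = (t₀/2, ∞)`, almost everywhere (`E ≥ 0`)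
    filter_upwards [ae_nonneg_of_measure_Iio μ h0] with p hp t ht
    have ht' : t₀ / 2 < t := ht
    rw [norm_neg, Real.norm_eq_abs, abs_mul, abs_mul, abs_of_nonneg hp, abs_of_pos (Real.exp_pos _), pow_one]
    refine mul_le_mul (mul_le_mul_of_nonneg_left ?_ hp) ((hΦb _).trans (le_abs_self C)) (abs_nonneg _)
      (mul_nonneg hp (Real.exp_pos _).le)
    exact Real.exp_le_exp.mpr (by nlinarith)
  · -- pointwise derivative
    refine Eventually.of_forall fun p t _ => ?_
    show HasDerivAt (fun t : ℝ => Real.exp (-(t * p.1)) * Φ p.2) (-(p.1 * Real.exp (-(t * p.1)) * Φ p.2)) t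
    have h1 : HasDerivAt (fun t : ℝ => -(t * p.1)) (-(1 * p.1)) t := ((hasDerivAt_id t).mul_const p.1).neg
    have h2 : HasDerivAt (fun t : ℝ => Real.exp (-(t * p.1)) * Φ p.2)
        (Real.exp (-(t * p.1)) * -(1 * p.1) * Φ p.2) t := h1.exp.mul_const _
    refine h2.congr_deriv ?_
    ring

/-! ## § 4. Chebyshev: the IR/UV growth bound of the slice measure -/

/-- **Chebyshev for Laplace transforms**: for `Φ ≥ 0` and `t > 0`, `∫_{E ≤ 1/t} Φ dμ ≤ e · ∫ e^{−tE} Φ dμ`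
(since `e^{−tE} ≥ e^{−1}` on `E ≤ 1/t`). [folklore] -/
theorem setIntegral_le_exp_mul_integral (μ : Measure (ℝ × EuclideanSpace ℝ (Fin 3)))
    (h0 : μ (Set.Iio (0 : ℝ) ×ˢ (Set.univ : Set (EuclideanSpace ℝ (Fin 3)))) = 0)
    (hint : ∀ t : ℝ, 0 < t → Integrable (fun p : ℝ × EuclideanSpace ℝ (Fin 3) => Real.exp (-(t * p.1))) μ)
    (Φ : EuclideanSpace ℝ (Fin 3) → ℝ) (hΦm : Measurable Φ) {C : ℝ} (hΦb : ∀ q, |Φ q| ≤ C) (hΦ0 : ∀ q, 0 ≤ Φ q)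
    {t : ℝ} (ht : 0 < t) :
    ∫ p in {p | p.1 ≤ 1 / t}, Φ p.2 ∂μ ≤ Real.exp 1 * ∫ p, Real.exp (-(t * p.1)) * Φ p.2 ∂μ := by
  have hF : Integrable (fun p : ℝ × EuclideanSpace ℝ (Fin 3) => Real.exp (-(t * p.1)) * Φ p.2) μ := by
    simpa using integrable_pow_mul_exp_mul μ h0 hint Φ hΦm hΦb ht 0
  have hS : MeasurableSet {p : ℝ × EuclideanSpace ℝ (Fin 3) | p.1 ≤ 1 / t} :=
    measurableSet_le measurable_fst measurable_const
  -- on the slab, `Φ ≤ e · e^{−tE} Φ`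
  have hle : ∀ p ∈ {p : ℝ × EuclideanSpace ℝ (Fin 3) | p.1 ≤ 1 / t},
      Φ p.2 ≤ Real.exp 1 * (Real.exp (-(t * p.1)) * Φ p.2) := by
    intro p hp
    simp only [Set.mem_setOf_eq] at hp
    have h1 : 1 ≤ Real.exp 1 * Real.exp (-(t * p.1)) := by
      rw [← Real.exp_add]
      apply Real.one_le_exp
      have : t * p.1 ≤ 1 := by
        calc t * p.1 ≤ t * (1 / t) := mul_le_mul_of_nonneg_left hp ht.le
          _ = 1 := by field_simp
      linarith
    calc Φ p.2 = 1 * Φ p.2 := (one_mul _).symm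
      _ ≤ (Real.exp 1 * Real.exp (-(t * p.1))) * Φ p.2 := mul_le_mul_of_nonneg_right h1 (hΦ0 _)
      _ = Real.exp 1 * (Real.exp (-(t * p.1)) * Φ p.2) := by ring
  -- integrability of `Φ ∘ snd` on the slab (dominated there)
  have hΦS : IntegrableOn (fun p : ℝ × EuclideanSpace ℝ (Fin 3) => Φ p.2) {p | p.1 ≤ 1 / t} μ := by
    refine ((hF.const_mul (Real.exp 1)).integrableOn).mono' (hΦm.comp measurable_snd).aestronglyMeasurable ?_
    refine (ae_restrict_iff' hS).mpr (Eventually.of_forall fun p hp => ?_)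
    rw [Real.norm_eq_abs, abs_of_nonneg (hΦ0 _)]
    exact hle p hp
  calc ∫ p in {p | p.1 ≤ 1 / t}, Φ p.2 ∂μ
      ≤ ∫ p in {p | p.1 ≤ 1 / t}, Real.exp 1 * (Real.exp (-(t * p.1)) * Φ p.2) ∂μ :=
        setIntegral_mono_on hΦS ((hF.const_mul _).integrableOn) hS hle
    _ ≤ ∫ p, Real.exp 1 * (Real.exp (-(t * p.1)) * Φ p.2) ∂μ :=
        setIntegral_le_integral (hF.const_mul _)
          (Eventually.of_forall fun p => mul_nonneg (Real.exp_pos _).le (mul_nonneg (Real.exp_pos _).le (hΦ0 _)))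
    _ = Real.exp 1 * ∫ p, Real.exp (-(t * p.1)) * Φ p.2 ∂μ := integral_const_mul _ _

/-! ## § 5. Higher time derivatives: `dⁿ/dtⁿ` of a smeared slice is the `n`-th `E`-moment (appended, g14) -/

/-- **All time derivatives of smeared slices are `E`-moments**: for `t₀ > 0`, bounded measurable `Φ` and every `n`,
`d/dt|_{t₀} ∫ Eⁿ e^{−tE} Φ(q⃗) dμ = −∫ E^{n+1} e^{−t₀E} Φ(q⃗) dμ`; iterating from `hasDerivAt_integral_exp_mul` gives
`∂_tⁿ ∫ e^{−tE} Φ dμ = (−1)ⁿ ∫ Eⁿ e^{−tE} Φ dμ` on `t > 0` (so `∂_t² ↔ E²`, the time half of `Δ₄ ↔ E² − |q⃗|²`). [folklore] -/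
theorem hasDerivAt_integral_pow_mul_exp_mul (μ : Measure (ℝ × EuclideanSpace ℝ (Fin 3)))
    (h0 : μ (Set.Iio (0 : ℝ) ×ˢ (Set.univ : Set (EuclideanSpace ℝ (Fin 3)))) = 0)
    (hint : ∀ t : ℝ, 0 < t → Integrable (fun p : ℝ × EuclideanSpace ℝ (Fin 3) => Real.exp (-(t * p.1))) μ)
    (Φ : EuclideanSpace ℝ (Fin 3) → ℝ) (hΦm : Measurable Φ) {C : ℝ} (hΦb : ∀ q, |Φ q| ≤ C)
    (n : ℕ) {t₀ : ℝ} (ht₀ : 0 < t₀) :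
    HasDerivAt (fun t : ℝ => ∫ p, p.1 ^ n * Real.exp (-(t * p.1)) * Φ p.2 ∂μ)
      (-∫ p, p.1 ^ (n + 1) * Real.exp (-(t₀ * p.1)) * Φ p.2 ∂μ) t₀ := by
  have hC : 0 ≤ C := (abs_nonneg _).trans (hΦb 0)
  have hmeasF : ∀ t : ℝ, AEStronglyMeasurable
      (fun p : ℝ × EuclideanSpace ℝ (Fin 3) => p.1 ^ n * Real.exp (-(t * p.1)) * Φ p.2) μ := by
    intro t
    have h1 : Measurable fun p : ℝ × EuclideanSpace ℝ (Fin 3) => p.1 ^ n * Real.exp (-(t * p.1)) := by fun_prop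
    exact (h1.mul (hΦm.comp measurable_snd)).aestronglyMeasurable
  have hmeasF' : AEStronglyMeasurable
      (fun p : ℝ × EuclideanSpace ℝ (Fin 3) => -(p.1 ^ (n + 1) * Real.exp (-(t₀ * p.1)) * Φ p.2)) μ := by
    have h1 : Measurable fun p : ℝ × EuclideanSpace ℝ (Fin 3) => p.1 ^ (n + 1) * Real.exp (-(t₀ * p.1)) := by fun_prop
    exact (h1.mul (hΦm.comp measurable_snd)).aestronglyMeasurable.neg
  have hbound : Integrable (fun p : ℝ × EuclideanSpace ℝ (Fin 3) => p.1 ^ (n + 1) * Real.exp (-(t₀ / 2 * p.1)) * |C|) μ :=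
    integrable_pow_mul_exp_mul μ h0 hint (fun _ => |C|) measurable_const (C := |C|) (fun _ => by rw [abs_abs])
      (half_pos ht₀) (n + 1)
  have key := hasDerivAt_integral_of_dominated_loc_of_deriv_le (μ := μ) (x₀ := t₀)
    (F := fun (t : ℝ) (p : ℝ × EuclideanSpace ℝ (Fin 3)) => p.1 ^ n * Real.exp (-(t * p.1)) * Φ p.2)
    (F' := fun (t : ℝ) (p : ℝ × EuclideanSpace ℝ (Fin 3)) => -(p.1 ^ (n + 1) * Real.exp (-(t * p.1)) * Φ p.2))
    (s := Set.Ioi (t₀ / 2)) (bound := fun p => p.1 ^ (n + 1) * Real.exp (-(t₀ / 2 * p.1)) * |C|)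
    (Ioi_mem_nhds (by linarith)) (Eventually.of_forall hmeasF) (integrable_pow_mul_exp_mul μ h0 hint Φ hΦm hΦb ht₀ n)
    hmeasF' ?_ hbound ?_
  · simpa [integral_neg] using key.2
  · filter_upwards [ae_nonneg_of_measure_Iio μ h0] with p hp t ht
    have ht' : t₀ / 2 < t := ht
    rw [norm_neg, Real.norm_eq_abs, abs_mul, abs_mul, abs_of_nonneg (pow_nonneg hp _), abs_of_pos (Real.exp_pos _)]
    refine mul_le_mul (mul_le_mul_of_nonneg_left ?_ (pow_nonneg hp _)) ((hΦb _).trans (le_abs_self C)) (abs_nonneg _)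
      (mul_nonneg (pow_nonneg hp _) (Real.exp_pos _).le)
    exact Real.exp_le_exp.mpr (by nlinarith)
  · refine Eventually.of_forall fun p t _ => ?_
    show HasDerivAt (fun t : ℝ => p.1 ^ n * Real.exp (-(t * p.1)) * Φ p.2) (-(p.1 ^ (n + 1) * Real.exp (-(t * p.1)) * Φ p.2)) t
    have h1 : HasDerivAt (fun t : ℝ => -(t * p.1)) (-(1 * p.1)) t := ((hasDerivAt_id t).mul_const p.1).neg
    have h2 : HasDerivAt (fun t : ℝ => p.1 ^ n * Real.exp (-(t * p.1)) * Φ p.2)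
        (p.1 ^ n * (Real.exp (-(t * p.1)) * -(1 * p.1)) * Φ p.2) t := (h1.exp.const_mul _).mul_const _
    refine h2.congr_deriv ?_
    ring

end Summit.QuantumFields.YangMills.Theorems.F4SubCurvatureDoorSmearedSlices

end
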